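import Summits.HubbardSuperconductivity.HubbardSuperconductivity.Theses.BalabanIR
import Summits.HubbardSuperconductivity.HubbardSuperconductivity.Theorems.BalabanIRBirEveryGroundStateSocketResidues
import Literature.MathematicalPhysics.QuantumLattice.PairFieldMomentum

/-!
# Line `fejer-split-chord` (payload slug `Sketch-ideator4`) — eligible skeleton, crux
stmt-HubbardSuperconductivity-2083 (`Theses.BalabanIR.BirEveryGroundState`)

Lead prover-line-stmt-HubbardSuperconductivity-2083-a3-0, 2026-08-16.  Rebuilt from the ideator's
`Cruxes/BirEveryGroundState/Sketch_ideator4.lean` (card `Ideas/fejer-split-chord.md`), which has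
NO `BirEveryGroundState_of` and NO `stub_*` theorem (0 sorries; its two load-bearing statements are
the `Prop` definitions `LocalPairCoercivityAt` / `PairStiffnessAt`), hence is not L0-eligible as
given.  This file keeps the ideator's objects and PROVED glue verbatim (`modeOp`, `localOrderOp`,
`twistOp`, `fejerWeight`, `localOrderOp_sub_twistOp`, `chord_of_local_of_stiffness`,
`kappaChordAt_of_local_of_stiffness`) and adds

* two registered stubs, each FED with the crux's window-average hypothesis (the only datum the
  crux offers) and stated at EVERY coupling of the window (the card's re-cut R1: "(S1) ∧ (S2) at
  every U of the window"):
  `stub_localCoercivity` — (S1) with an `R`-independent floor `a > 0` at all large ranges `R`;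
  `stub_pairStiffness`  — (S2) with allowance `ε → 0` as `R → ∞`;
* the composition `BirEveryGroundState_of : Theses.BalabanIR.BirEveryGroundState` (sorry-free
  modulo the two stubs): midpoint coupling, `ε = a/2`, `R = max R₁ R₂ ⊔ 1`,
  `kappaChordAt_of_local_of_stiffness`, then the landed Theses-free closer
  `Theorems.birEveryGroundState_structural_of_kappaChord` (p85986).

STATUS: the line is DEAD inside crux 5 as typed — see `Lines/Sketch-ideator4.dead.md`.  Both stubs
ignore their antecedent in substance (a GS-average lower bound on `Δ_d†Δ_d` constrains no sector
ground ENERGY difference; Disproof §2's pencil satisfies every average datum while its chord is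
identically zero), so each is a free-standing theorem on T = 0 d-wave pair order of doped repulsive
Hubbard tori — the engine deliverables of the re-cut, not lemmas available to any worker.
-/

set_option linter.dupNamespace false

noncomputable section

namespace Summit.HubbardSuperconductivity.HubbardSuperconductivity.Cruxes.BirEveryGroundState.FejerSplitChord

open Matrix Finset Literature.Probability.LatticeModels Literature.MathematicalPhysics.QuantumLattice
open scoped ComplexOrder

/-! ### Abstract glue (ideator 4, proved): the chord is a convex combination -/

section Abstract

variable {n : Type*} [Fintype n]

private theorem re_rayleigh_add_smul (H M : Matrix n n ℂ) (c : ℝ) (φ : n → ℂ) :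
    (star φ ⬝ᵥ (H + (c : ℂ) • M) *ᵥ φ).re =
      (star φ ⬝ᵥ H *ᵥ φ).re + c * (star φ ⬝ᵥ M *ᵥ φ).re := by
  rw [add_mulVec, dotProduct_add, Complex.add_re, smul_mulVec, dotProduct_smul, smul_eq_mul,
    Complex.re_ofReal_mul]

private theorem re_rayleigh_sub_smul (H M : Matrix n n ℂ) (c : ℝ) (φ : n → ℂ) :
    (star φ ⬝ᵥ (H - (c : ℂ) • M) *ᵥ φ).re =
      (star φ ⬝ᵥ H *ᵥ φ).re - c * (star φ ⬝ᵥ M *ᵥ φ).re := by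
  rw [sub_mulVec, dotProduct_sub, Complex.sub_re, smul_mulVec, dotProduct_smul, smul_eq_mul,
    Complex.re_ofReal_mul]

private theorem re_rayleigh_sub (A B : Matrix n n ℂ) (φ : n → ℂ) :
    (star φ ⬝ᵥ (A - B) *ᵥ φ).re = (star φ ⬝ᵥ A *ᵥ φ).re - (star φ ⬝ᵥ B *ᵥ φ).re := by
  rw [sub_mulVec, dotProduct_sub, Complex.sub_re]

private theorem real_glue {E h α β a b κ₁ κ₂ : ℝ} (hκ₁ : 0 < κ₁) (hκ₂ : 0 < κ₂)
    (h1 : E + κ₁ * a ≤ h + κ₁ * α) (h2 : E - κ₂ * b ≤ h - κ₂ * β) :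
    E + κ₁ * κ₂ / (κ₁ + κ₂) * (a - b) ≤ h + κ₁ * κ₂ / (κ₁ + κ₂) * (α - β) := by
  have hs : 0 < κ₁ + κ₂ := add_pos hκ₁ hκ₂
  rw [← sub_nonneg]
  have key : (h + κ₁ * κ₂ / (κ₁ + κ₂) * (α - β)) - (E + κ₁ * κ₂ / (κ₁ + κ₂) * (a - b)) =
      ((κ₂ * (h + κ₁ * α) - κ₂ * (E + κ₁ * a)) + (κ₁ * (h - κ₂ * β) - κ₁ * (E - κ₂ * b))) /
        (κ₁ + κ₂) := by
    field_simp
    ring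
  rw [key]
  apply div_nonneg _ hs.le
  nlinarith [mul_le_mul_of_nonneg_left h1 hκ₂.le, mul_le_mul_of_nonneg_left h2 hκ₁.le]

/-- **The κ-chord as a convex combination** (card `fejer-split-chord`, glue; PROVED by ideator 4).
If `minE_K H + κ₁ a ≤ minE_K (H + κ₁ A)` and `minE_K H − κ₂ b ≤ minE_K (H − κ₂ B)` then, with
`η := κ₁κ₂/(κ₁+κ₂)`, `minE_K H + η (a − b) ≤ minE_K (H + η (A − B))`. [folklore] -/
theorem chord_of_local_of_stiffness (H A B : Matrix n n ℂ) (K : Submodule ℂ (n → ℂ))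
    {κ₁ κ₂ a b : ℝ} (hκ₁ : 0 < κ₁) (hκ₂ : 0 < κ₂)
    (hloc : H.minEnergyOn K + κ₁ * a ≤ (H + (κ₁ : ℂ) • A).minEnergyOn K)
    (hstiff : H.minEnergyOn K - κ₂ * b ≤ (H - (κ₂ : ℂ) • B).minEnergyOn K) :
    H.minEnergyOn K + κ₁ * κ₂ / (κ₁ + κ₂) * (a - b) ≤
      (H + ((κ₁ * κ₂ / (κ₁ + κ₂) : ℝ) : ℂ) • (A - B)).minEnergyOn K := by
  by_cases hne : ∃ ψ ∈ K, star ψ ⬝ᵥ ψ = 1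
  · obtain ⟨ψ₀, hψ₀K, hψ₀⟩ := hne
    change _ ≤ sInf _
    refine le_csInf ⟨_, ψ₀, hψ₀K, hψ₀, rfl⟩ ?_
    rintro e ⟨φ, hφK, hφ, rfl⟩
    have h1 := hloc.trans (Theorems.minEnergyOn_le_re_rayleigh (H + (κ₁ : ℂ) • A) K hφK hφ)
    have h2 := hstiff.trans (Theorems.minEnergyOn_le_re_rayleigh (H - (κ₂ : ℂ) • B) K hφK hφ)
    rw [re_rayleigh_add_smul] at h1
    rw [re_rayleigh_sub_smul] at h2
    rw [re_rayleigh_add_smul, re_rayleigh_sub]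
    exact real_glue hκ₁ hκ₂ h1 h2
  · have hempty : ∀ M : Matrix n n ℂ, M.minEnergyOn K = 0 := by
      intro M
      rw [Matrix.minEnergyOn]
      convert Real.sInf_empty
      ext E
      simp only [Set.mem_setOf_eq, Set.mem_empty_iff_false, iff_false]
      rintro ⟨ψ, hψK, hψ, -⟩
      exact hne ⟨ψ, hψK, hψ⟩
    rw [hempty, hempty] at hloc hstiff
    rw [hempty, hempty]
    have hs : 0 < κ₁ + κ₂ := add_pos hκ₁ hκ₂
    have ha : a ≤ 0 := by nlinarith
    have hb : 0 ≤ b := by nlinarith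
    have : κ₁ * κ₂ / (κ₁ + κ₂) * (a - b) ≤ 0 :=
      mul_nonpos_of_nonneg_of_nonpos (by positivity) (by linarith)
    linarith

end Abstract

/-! ### The Fejér split of the d-wave order operator on the fermionic torus (ideator 4) -/

section Torus

variable (L : ℕ) [NeZero L]

/-- `modeOp L m = L⁻⁴ Δ_d(m)ᴴ Δ_d(m)`, the normalised d-wave pair intensity at momentum label `m`.
[folklore] -/
def modeOp (m : TorusSite 2 L) :
    Matrix (Finset (Orb (FermionTorus 2 L))) (Finset (Orb (FermionTorus 2 L))) ℂ :=
  ((1 : ℂ) / (L : ℂ) ^ 4) • ((pairFieldAt dWaveFormFactor L m)ᴴ * pairFieldAt dWaveFormFactor L m)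

/-- Weighted LOCAL ORDER operator `Σ_m w(m) • modeOp L m`. [folklore] -/
def localOrderOp (w : TorusSite 2 L → ℝ) :
    Matrix (Finset (Orb (FermionTorus 2 L))) (Finset (Orb (FermionTorus 2 L))) ℂ :=
  ∑ m, ((w m : ℝ) : ℂ) • modeOp L m

/-- Weighted FINITE-MOMENTUM ("twist") operator `Σ_{m ≠ 0} w(m) • modeOp L m`. [folklore] -/
def twistOp (w : TorusSite 2 L → ℝ) :
    Matrix (Finset (Orb (FermionTorus 2 L))) (Finset (Orb (FermionTorus 2 L))) ℂ :=
  ∑ m ∈ (Finset.univ : Finset (TorusSite 2 L)).erase 0, ((w m : ℝ) : ℂ) • modeOp L m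

/-- The Fejér weight `F̂_R(m) = R⁻⁴ |Σ_{a ∈ [0,R)²} χ_m(a)|²`. [folklore] -/
def fejerWeight (R : ℕ) (m : TorusSite 2 L) : ℝ :=
  ‖∑ a : Fin 2 → Fin R, torusChar m (fun i => ((a i : ℕ) : ZMod L))‖ ^ 2 / (R : ℝ) ^ 4

/-- **FEJÉR SPLIT** (proved): for any weight with `w 0 = 1`,
`localOrderOp L w − twistOp L w = L⁻⁴ Δ_dᴴ Δ_d`. [folklore] -/
theorem localOrderOp_sub_twistOp (w : TorusSite 2 L → ℝ) (hw : w 0 = 1) :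
    localOrderOp L w - twistOp L w =
      ((1 : ℂ) / (L : ℂ) ^ 4) • ((pairField dWaveFormFactor L)ᴴ * pairField dWaveFormFactor L) := by
  rw [twistOp, Finset.sum_erase_eq_sub (Finset.mem_univ _),
    show (∑ m, ((fun m => ((w m : ℝ) : ℂ) • modeOp L m) m)) = localOrderOp L w from rfl, sub_sub_cancel]
  simp only [hw, Complex.ofReal_one, one_smul, modeOp, pairFieldAt_zero]

/-- `F̂_R(0) = 1` for `R ≥ 1`. [folklore] -/
theorem fejerWeight_zero (R : ℕ) (hR : R ≠ 0) : fejerWeight L R 0 = 1 := by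
  have hR' : (R : ℝ) ≠ 0 := Nat.cast_ne_zero.mpr hR
  have hsum : (∑ a : Fin 2 → Fin R, torusChar (0 : TorusSite 2 L) (fun i => ((a i : ℕ) : ZMod L))) =
      ((R : ℂ)) ^ 2 := by
    simp only [torusChar_zero_left, Finset.sum_const, Finset.card_univ, nsmul_eq_mul, mul_one,
      Fintype.card_pi, Fintype.card_fin, Finset.prod_const]
    push_cast
    ring
  rw [fejerWeight, hsum, norm_pow, Complex.norm_natCast, ← pow_mul,
    show 2 * 2 = 4 by norm_num, div_self (pow_ne_zero 4 hR')]

end Torus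

/-! ### The two inequalities (Hubbard shell) and their composition into the κ-chord -/

/-- (S1) **local pair-order coercivity** at `(U, δ)`, range `R`, strength `κ`, floor `a`:
eventually in even `L`, `minE_S H + κ a ≤ minE_S (H + κ • localOrderOp L (fejerWeight L R))`.
Engine deliverable; NOT a consequence of the crux's hypothesis. -/
def LocalPairCoercivityAt (U δ : ℝ) (R : ℕ) (κ a : ℝ) : Prop :=
  ∃ L₀ : ℕ, ∀ (L : ℕ) [NeZero L], L₀ ≤ L → Even L →
    let N : ℕ := 2 * ⌊(1 - δ) * (L : ℝ) ^ 2 / 2⌋₊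
    let H := hubbardTorus 2 L 1 U
    let S := szSector (Λ := FermionTorus 2 L) N 0
    H.minEnergyOn S + κ * a ≤ (H + (κ : ℂ) • localOrderOp L (fejerWeight L R)).minEnergyOn S

/-- (S2) **pair stiffness against slow twists** at `(U, δ)`, range `R`, strength `κ`, allowance `b`:
eventually in even `L`, `minE_S H − κ b ≤ minE_S (H − κ • twistOp L (fejerWeight L R))`.
Engine deliverable; NOT a consequence of the crux's hypothesis. -/
def PairStiffnessAt (U δ : ℝ) (R : ℕ) (κ b : ℝ) : Prop :=
  ∃ L₀ : ℕ, ∀ (L : ℕ) [NeZero L], L₀ ≤ L → Even L →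
    let N : ℕ := 2 * ⌊(1 - δ) * (L : ℝ) ^ 2 / 2⌋₊
    let H := hubbardTorus 2 L 1 U
    let S := szSector (Λ := FermionTorus 2 L) N 0
    H.minEnergyOn S - κ * b ≤ (H - (κ : ℂ) • twistOp L (fejerWeight L R)).minEnergyOn S

/-- The κ-chord at `(U, δ)` — verbatim the per-coupling body of the hypothesis of the landed closer
`Theorems.birEveryGroundState_structural_of_kappaChord`. -/
def KappaChordAt (U δ : ℝ) : Prop :=
  ∃ κ a : ℝ, 0 < κ ∧ 0 < a ∧ ∃ L₀ : ℕ, ∀ (L : ℕ) [NeZero L], L₀ ≤ L → Even L →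
    let N : ℕ := 2 * ⌊(1 - δ) * (L : ℝ) ^ 2 / 2⌋₊
    let H := hubbardTorus 2 L 1 U
    let S := szSector (Λ := FermionTorus 2 L) N 0
    let Yd : Matrix (Finset (Orb (FermionTorus 2 L))) (Finset (Orb (FermionTorus 2 L))) ℂ :=
      ((1 : ℂ) / (L : ℂ) ^ 4) • ((pairField dWaveFormFactor L)ᴴ * pairField dWaveFormFactor L)
    κ * a ≤ (H + (κ : ℂ) • Yd).minEnergyOn S - H.minEnergyOn S

/-- **Composition** (proved by ideator 4): (S1) with floor `a` and (S2) with allowance `b < a` at the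
same `(U, δ, R)` give the κ-chord. [folklore] -/
theorem kappaChordAt_of_local_of_stiffness (U δ : ℝ) {R : ℕ} (hR : R ≠ 0) {κ₁ κ₂ a b : ℝ}
    (hκ₁ : 0 < κ₁) (hκ₂ : 0 < κ₂) (hab : b < a)
    (hloc : LocalPairCoercivityAt U δ R κ₁ a) (hstiff : PairStiffnessAt U δ R κ₂ b) :
    KappaChordAt U δ := by
  obtain ⟨L₁, h1⟩ := hloc
  obtain ⟨L₂, h2⟩ := hstiff
  refine ⟨κ₁ * κ₂ / (κ₁ + κ₂), a - b, by positivity, by linarith, max L₁ L₂,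
    fun L _ hL hLe => ?_⟩
  have h1L := h1 L ((le_max_left _ _).trans hL) hLe
  have h2L := h2 L ((le_max_right _ _).trans hL) hLe
  simp only at h1L h2L ⊢
  have key := chord_of_local_of_stiffness (hubbardTorus 2 L 1 U) (localOrderOp L (fejerWeight L R))
    (twistOp L (fejerWeight L R))
    (szSector (Λ := FermionTorus 2 L) (2 * ⌊(1 - δ) * (L : ℝ) ^ 2 / 2⌋₊) 0) hκ₁ hκ₂ h1L h2L
  rw [localOrderOp_sub_twistOp L (fejerWeight L R) (fejerWeight_zero L R hR)] at key
  linarith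

/-! ### The crux's hypothesis, the two stubs, and the composition -/

/-- The window-average hypothesis of the crux for data `(δ, U₁, U₂, c)` — the `∀ U ∈ Set.Ioo U₁ U₂, …`
antecedent of `Theses.BalabanIR.BirEveryGroundState`, verbatim (definitionally equal). [folklore] -/
def WindowAvgHyp (δ U₁ U₂ c : ℝ) : Prop :=
  ∀ U ∈ Set.Ioo U₁ U₂, ∃ L₀ : ℕ, ∀ (L : ℕ) [NeZero L], L₀ ≤ L → Even L →
    let N : ℕ := 2 * ⌊(1 - δ) * (L : ℝ) ^ 2 / 2⌋₊
    let H := hubbardTorus 2 L 1 U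
    let S := szSector (Λ := FermionTorus 2 L) N 0
    let E₀ := S ⊓ Module.End.eigenspace (Matrix.toLin' H) ((H.minEnergyOn S : ℝ) : ℂ)
    let P := projMatrix (E₀.map (Fock.toEuclidean (ι := Orb (FermionTorus 2 L)) :
      Fock (Orb (FermionTorus 2 L)) →ₗ[ℂ] EuclideanSpace ℂ (Finset (Orb (FermionTorus 2 L)))))
    c * (L : ℝ) ^ 4 * P.trace.re ≤
      (P * ((pairField dWaveFormFactor L)ᴴ * pairField dWaveFormFactor L)).trace.re

/-- STUB 1 — (S1) at every coupling of a window carrying the crux's average hypothesis, with an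
`R`-independent floor `a > 0` at all large ranges `R` (physically `a ≈ m²`, the condensate density
squared).  UNFED: the antecedent `WindowAvgHyp` bounds GS-averages of `Δ_d†Δ_d` from below and says
nothing about sector ground ENERGIES under an added penalty; in substance this is "local d-wave pair
coherence is energetically rigid in doped repulsive Hubbard tori at T = 0" — open. -/
theorem stub_localCoercivity :
    ∀ (δ U₁ U₂ c : ℝ), δ ∈ Set.Ioo (0:ℝ) (1/2) → 0 < U₁ → U₁ < U₂ → 0 < c →
      WindowAvgHyp δ U₁ U₂ c → ∀ U ∈ Set.Ioo U₁ U₂,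
        ∃ a : ℝ, 0 < a ∧ ∃ R₀ : ℕ, ∀ R : ℕ, R₀ ≤ R →
          ∃ κ₁ : ℝ, 0 < κ₁ ∧ LocalPairCoercivityAt U δ R κ₁ a := by
  sorry

/-- STUB 2 — (S2) at every coupling of a window carrying the crux's average hypothesis, with
allowance `ε → 0` as the range `R → ∞` (physically `b(R) = O(ρ_s⁻¹R⁻²)` + correlation tail).
UNFED for the same reason; in substance "finite-momentum d-wave pairing costs O(1) energy — phase
stiffness `ρ_s > 0` — in doped repulsive Hubbard tori at T = 0" — open. -/
theorem stub_pairStiffness :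
    ∀ (δ U₁ U₂ c : ℝ), δ ∈ Set.Ioo (0:ℝ) (1/2) → 0 < U₁ → U₁ < U₂ → 0 < c →
      WindowAvgHyp δ U₁ U₂ c → ∀ U ∈ Set.Ioo U₁ U₂,
        ∀ ε : ℝ, 0 < ε → ∃ R₀ : ℕ, ∀ R : ℕ, R₀ ≤ R →
          ∃ κ₂ : ℝ, 0 < κ₂ ∧ PairStiffnessAt U δ R κ₂ ε := by
  sorry

/-- **COMPOSITION** — the line closes the crux BY NAME modulo the two stubs: at the midpoint coupling
take the floor `a` of (S1), the allowance `ε = a/2` of (S2), a common large range `R ≥ 1`, compose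
into the κ-chord (`kappaChordAt_of_local_of_stiffness`) and conclude by the landed closer
`Theorems.birEveryGroundState_structural_of_kappaChord`. [folklore] -/
theorem BirEveryGroundState_of : Theses.BalabanIR.BirEveryGroundState := by
  unfold Theses.BalabanIR.BirEveryGroundState
  refine Theorems.birEveryGroundState_structural_of_kappaChord ?_
  intro δ U₁ U₂ c hδ hU₁ hU₁₂ hc hyp
  have hU : (U₁ + U₂) / 2 ∈ Set.Ioo U₁ U₂ := ⟨by linarith, by linarith⟩
  obtain ⟨a, ha, R₁, h1⟩ := stub_localCoercivity δ U₁ U₂ c hδ hU₁ hU₁₂ hc hyp _ hU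
  obtain ⟨R₂, h2⟩ := stub_pairStiffness δ U₁ U₂ c hδ hU₁ hU₁₂ hc hyp _ hU (a / 2) (by linarith)
  obtain ⟨κ₁, hκ₁, hloc⟩ := h1 (max (max R₁ R₂) 1) ((le_max_left _ _).trans (le_max_left _ _))
  obtain ⟨κ₂, hκ₂, hstiff⟩ := h2 (max (max R₁ R₂) 1) ((le_max_right _ _).trans (le_max_left _ _))
  have hR : max (max R₁ R₂) 1 ≠ 0 := Nat.pos_iff_ne_zero.mp (lt_of_lt_of_le one_pos (le_max_right _ _))
  exact ⟨(U₁ + U₂) / 2, hU,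
    kappaChordAt_of_local_of_stiffness _ δ hR hκ₁ hκ₂ (by linarith : a / 2 < a) hloc hstiff⟩

end Summit.HubbardSuperconductivity.HubbardSuperconductivity.Cruxes.BirEveryGroundState.FejerSplitChord
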